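import Literature.NumberTheory.Automorphic.SLTwoTreeQuadraticTorusFixedShells   -- ★ (W′1) I (A-p17 (g23)) p843889: `coe_inv_mul_torus_mul_of_coe_eq_diagonal`, `isIntegralMatrix_shellConj_iff`; ⊇ ★ p08 `QuadraticOrderRegularRepShells`
import Mathlib.RingTheory.Ideal.Norm.AbsNorm
import HarnessLib

/-!
# The non-split quadratic torus on the tree of `SL₂(F)`, V-INDEX: the conductor-`m` unit index `[𝒪_E^× : (𝒪 + ϖ^m 𝒪 τ)^×] = q^m` in EISENSTEIN coordinates
# (Labesse–Langlands 1979 §2 p. 8, `δ_m = 2q^m`; Labesse 2024 Prop. 0.0.10, `C(ϖ^{−m}) = 2q^m`)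

Topic `NumberTheory/Automorphic`; namespace `Literature.NumberTheory.Automorphic.HermitianLatticeTree` (ROAD W's).  KERNEL mathematics only: theorems, no definition, no
named fact, no instance, no notation, no `sorry`.  Cell `pub/hodgecm-mathlib` (D-0151), crux H413 = `stmt-HodgeConjecture-24833`, line «N6nsGerm», road «W′» =
«R1LL-WILD» (LEAD F0P3a-plan (g10) WORD T9-25; architect A-p16 (g28) RULINGS A-37 FLAG 1 (Eisenstein basis), A-38 (c), A-40 (a) (the (W′1)-V SPLIT:
(V-ORBIT) A-p17 (g23) ∥ (V-INDEX) this file)); seat A-p01 (g21), census `A-provers/A-p01/g21/CENSUS-W1V-ShellCardinality.A-p01g21.md`.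
HONEST LABEL: HC_CM is proved only modulo the cell's 2 remaining named inputs (hLiu418, h413) until rung 0 closes; nothing printed is asserted here — elementary
`2 × 2` algebra over a discrete valuation ring with finite residue field.

THE MATHEMATICS (tokens of (W′1) I–IV: torus `T = {(c, ev; e, c + eu)} ⊂ GL₂(F)` = the regular representation of `F[τ]^×`, `τ² = uτ + v`, companion matrix
`γτ = (0, v; 1, u)` of `τ`, shell representative `r_m = diag(1, ϖ^m)`).  EISENSTEIN SHAPE (A-37 FLAG 1: at a ramified place take `τ = ϖ_E` a uniformiser of `E`, so
`u = tr ϖ_E ∈ 𝔭` and `|v| = |N ϖ_E| = |ϖ|`): hypotheses `hu1 : |u| < 1`, `hv1 : |v| = |ϖ|`.  The two subgroups of `GL₂(F)` of A-p17's (V-ORBIT) interface are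
  `TK := Subgroup.centralizer {γτ} ⊓ GL₂(𝒪)`  (= `𝒪_E^×`: `t` commutes with `γτ` iff `↑t = (c, ev; e, c + eu)`, §2)   and
  `TKm := TK ⊓ r_m GL₂(𝒪) r_m⁻¹`  (= `(𝒪 + ϖ^m𝒪τ)^×`: for `t ∈ TK`, `r_m⁻¹ t r_m ∈ GL₂(𝒪)` iff `|e| ≤ |ϖ|^m`, ★ I `isIntegralMatrix_shellConj_iff`),
and THE NUMBER is **`TKm.relIndex TK = q^m`** (Mathlib `Subgroup.relIndex`), `q = #𝓀_F`.  Proof (LL79 p. 8 ∕ Labesse 2024 Prop. 0.0.10, «`card(𝒪_E^×∕(1+𝔭_E^{2m}))∕card(𝒪_F^×∕…)`», done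
without the field `E`): for `t = (c, ev; e, c+eu) ∈ TK` the Eisenstein shape forces `|c| = 1` (`N = c² + ceu − e²v ≡ c²` mod `𝔭`, §1); the τ-coordinate of `t⁻¹t′` is
`(ce′ − ec′)∕N(t)`, so **`t TKm = t′ TKm ⟺ e∕c ≡ e′∕c′ (mod ϖ^m)`** (§3), i.e. `t ↦ e·c⁻¹ mod 𝔪^m` is a well-defined INJECTION `TK ∕ TKm → 𝒪 ∕ 𝔪^m` of coset SPACES (it
is not a homomorphism), ONTO by `t = 1 + eτ`; hence `[TK : TKm] = #(𝒪∕𝔪^m) = q^m` (`𝔪 = (ϖ)`, Mathlib `cardQuot_pow_of_prime`).  A-p17's (V-ORBIT) multiplies by the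
factor `2 = [E^× : F^×𝒪_E^×]` (ramified: `|det γτ| = |v| = |ϖ|`, `valuation_det_companion_eq` below) to get the shell cardinality `#{x | d x = m} = 2q^m`, the `C_m`
of the WILD DISPLAY of record (A-p12 (g19) `W0-WildDisplay-Labesse` §B2; B-p12 (g29) dyadic certificate (i)).
* §1 Eisenstein units: `valuation_eq_one_of_eisenstein_norm` (`|N(c+eτ)| = 1`, `c e ∈ 𝒪` ⇒ `|c| = 1`), `valuation_eisenstein_norm_one_add` (`|N(1 + eτ)| = 1`),
  `valuation_det_companion_eq` (`|det γτ| = |ϖ|`).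
* §2 the torus as a centraliser: `exists_coe_eq_regRep_of_mem_centralizer_companion` (`t γτ = γτ t ⇒ ↑t = (c, ev; e, c+eu)`), `regRep_mem_centralizer_companion` (converse).
* §3 `mem_maximalIdeal_pow_iff_valuation_le_pow` (`𝔪^m = {z : |z| ≤ |ϖ|^m}`), the COSET CRITERION `inv_mul_mem_conj_glInt_iff_of_mem_torusInt`, and the HEAD
  **`relIndex_torusInt_shellStab_eq`** (statement-first spelling posted 11:42Z, adopted byte-for-byte by (V-ORBIT)).

## References
* [LabesseLanglands1979] J.-P. Labesse, R. P. Langlands, *L-indistinguishability for SL(2)*, Canad. J. Math. 31 (1979), §2 p. 8 (orders `𝒪 + ϖ^m𝒪_E`, `δ_m`).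
* [Labesse2024StabilisationGermesSL2] J.-P. Labesse, *Stabilisation et germes pour SL(2) en toutes caractéristiques*, arXiv:2411.14820 (2024/25), Prop. 0.0.10
  (`C(μ) = 2|μ|` for `E∕F` ramified, via the two unit-group cardinalities).
* [Serre1980Trees] J.-P. Serre, *Trees* (1980), Ch. II §1.1, §1.3 (stabilisers `F^×·GL₂(𝒪)`).
-/

set_option autoImplicit false

noncomputable section

open scoped ValuativeRel Matrix MatrixGroups
open Matrix ValuativeRel

namespace Literature.NumberTheory.Automorphic.HermitianLatticeTree

open Literature.NumberTheory.Automorphic Literature.NumberTheory.LocalFields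

variable {F : Type*} [Field F] [ValuativeRel F] {ϖ : F} (hϖ : IsUniformizingElement ϖ)

/-! ## §1 Eisenstein units -/

include hϖ in
/-- In the Eisenstein shape (`|u| < 1`, `|v| = |ϖ|`), an element `c + eτ` with `c e ∈ 𝒪` has unit norm `N = c² + ceu − e²v` iff `c` is a unit; this is the
direction `|N| = 1 ⇒ |c| = 1` (`N ≡ c²` mod `𝔭`). [cite: LabesseLanglands1979, §2 p. 8] [cite: Serre1980Trees, Ch. II §1.1] -/
theorem valuation_eq_one_of_eisenstein_norm {u v c e : F} (hu1 : valuation F u < 1) (hv1 : valuation F v = valuation F ϖ)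
    (hc : c ∈ 𝒪[F]) (he : e ∈ 𝒪[F]) (hN : valuation F (c ^ 2 + c * e * u - e ^ 2 * v) = 1) : valuation F c = 1 := by
  have hc1 : valuation F c ≤ 1 := (Valuation.mem_integer_iff _ _).1 hc
  have he1 : valuation F e ≤ 1 := (Valuation.mem_integer_iff _ _).1 he
  by_contra hne
  have hclt : valuation F c < 1 := lt_of_le_of_ne hc1 hne
  have h1 : valuation F (c ^ 2) < 1 := by
    rw [map_pow, pow_two]; exact mul_lt_one_of_nonneg_of_lt_one_left zero_le hclt hc1
  have h2 : valuation F (c * e * u) < 1 := by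
    rw [map_mul, map_mul]
    exact mul_lt_one_of_nonneg_of_lt_one_right (mul_le_one' hc1 he1) zero_le hu1
  have h3 : valuation F (e ^ 2 * v) < 1 := by
    rw [map_mul, map_pow, pow_two, hv1]
    exact mul_lt_one_of_nonneg_of_lt_one_right (mul_le_one' he1 he1) zero_le hϖ.valuation_lt_one
  have h12 : valuation F (c ^ 2 + c * e * u) < 1 := lt_of_le_of_lt (Valuation.map_add _ _ _) (max_lt h1 h2)
  have h123 : valuation F (c ^ 2 + c * e * u - e ^ 2 * v) < 1 := by
    rw [sub_eq_add_neg]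
    refine lt_of_le_of_lt (Valuation.map_add _ _ _) (max_lt h12 ?_)
    rwa [Valuation.map_neg]
  exact absurd hN h123.ne

include hϖ in
/-- In the Eisenstein shape, `N(1 + eτ) = 1 + eu − e²v` is a unit for every `e ∈ 𝒪`. [cite: LabesseLanglands1979, §2 p. 8] -/
theorem valuation_eisenstein_norm_one_add {u v e : F} (hu1 : valuation F u < 1) (hv1 : valuation F v = valuation F ϖ) (he : e ∈ 𝒪[F]) :
    valuation F ((1 : F) ^ 2 + 1 * e * u - e ^ 2 * v) = 1 := by
  have he1 : valuation F e ≤ 1 := (Valuation.mem_integer_iff _ _).1 he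
  have h2 : valuation F (1 * e * u) < 1 := by
    rw [one_mul, map_mul]; exact mul_lt_one_of_nonneg_of_lt_one_right he1 zero_le hu1
  have h3 : valuation F (-(e ^ 2 * v)) < 1 := by
    rw [Valuation.map_neg, map_mul, map_pow, pow_two, hv1]
    exact mul_lt_one_of_nonneg_of_lt_one_right (mul_le_one' he1 he1) zero_le hϖ.valuation_lt_one
  have h23 : valuation F (1 * e * u + -(e ^ 2 * v)) < 1 := lt_of_le_of_lt (Valuation.map_add _ _ _) (max_lt h2 h3)
  have h : valuation F (1 * e * u + -(e ^ 2 * v)) < valuation F ((1 : F) ^ 2) := by rwa [one_pow, map_one]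
  rw [show (1 : F) ^ 2 + 1 * e * u - e ^ 2 * v = (1 : F) ^ 2 + (1 * e * u + -(e ^ 2 * v)) by ring, Valuation.map_add_eq_of_lt_left _ h, one_pow, map_one]

/-- The companion matrix `γτ = (0, v; 1, u)` of `τ` has `det γτ = −v`; in the Eisenstein shape `|det γτ| = |ϖ|` — at a RAMIFIED place the torus contains elements of odd
norm valuation (the uniformiser `τ = ϖ_E`), the `π` of (V-ORBIT)'s «shell = TK·x_m ⊔ π·TK·x_m». [cite: LabesseLanglands1979, §2 p. 8] -/
theorem valuation_det_companion_eq {u v : F} (hv1 : valuation F v = valuation F ϖ) {γτ : GL (Fin 2) F}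
    (hγτ : (γτ : Matrix (Fin 2) (Fin 2) F) = !![0, v; 1, u]) : valuation F (γτ : Matrix (Fin 2) (Fin 2) F).det = valuation F ϖ := by
  rw [hγτ, Matrix.det_fin_two_of, zero_mul, zero_sub, Valuation.map_neg, mul_one, hv1]

/-! ## §2 The torus as the centraliser of the companion matrix -/

omit [ValuativeRel F] in
/-- **`t` commutes with `γτ = (0, v; 1, u)` ⇒ `t` is a regular-representation matrix `(c, ev; e, c + eu)`** (`c = t₀₀`, `e = t₁₀`). [cite: LabesseLanglands1979, §2 p. 7] -/
theorem exists_coe_eq_regRep_of_mem_centralizer_companion {u v : F} {γτ : GL (Fin 2) F} (hγτ : (γτ : Matrix (Fin 2) (Fin 2) F) = !![0, v; 1, u])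
    {t : GL (Fin 2) F} (ht : t ∈ Subgroup.centralizer ({γτ} : Set (GL (Fin 2) F))) :
    ∃ c e : F, (t : Matrix (Fin 2) (Fin 2) F) = !![c, e * v; e, c + e * u] := by
  have hcomm : γτ * t = t * γτ := (Subgroup.mem_centralizer_iff.1 ht) γτ (Set.mem_singleton _)
  have hM : (γτ : Matrix (Fin 2) (Fin 2) F) * (t : Matrix (Fin 2) (Fin 2) F) = (t : Matrix (Fin 2) (Fin 2) F) * (γτ : Matrix (Fin 2) (Fin 2) F) := by
    rw [← Units.val_mul, hcomm, Units.val_mul]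
  set T : Matrix (Fin 2) (Fin 2) F := (t : Matrix (Fin 2) (Fin 2) F) with hT
  have hTe : T = !![T 0 0, T 0 1; T 1 0, T 1 1] := Matrix.eta_fin_two T
  rw [hγτ, hTe, Matrix.mul_fin_two, Matrix.mul_fin_two] at hM
  have h00 := congrArg (fun M : Matrix (Fin 2) (Fin 2) F => M 0 0) hM
  have h11 := congrArg (fun M : Matrix (Fin 2) (Fin 2) F => M 1 0) hM
  simp only [Matrix.of_apply, Matrix.cons_val', Matrix.cons_val_zero, Matrix.cons_val_one, Matrix.cons_val_fin_one, Matrix.empty_val'] at h00 h11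
  have e01 : T 0 1 = T 1 0 * v := by linear_combination (-1 : F) * h00
  have e11 : T 1 1 = T 0 0 + T 1 0 * u := by linear_combination (-1 : F) * h11
  refine ⟨T 0 0, T 1 0, ?_⟩
  rw [hTe, e01, e11]
  ext i j
  fin_cases i <;> fin_cases j <;> simp

omit [ValuativeRel F] in
/-- Conversely every regular-representation matrix commutes with `γτ` (the order `𝒪[τ]` is commutative; ★ `regRep_comm` at `γτ = (0, 1·v; 1, 0 + 1·u)`).
[cite: LabesseLanglands1979, §2 p. 7] -/
theorem regRep_mem_centralizer_companion {u v c e : F} {γτ : GL (Fin 2) F} (hγτ : (γτ : Matrix (Fin 2) (Fin 2) F) = !![0, v; 1, u])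
    {t : GL (Fin 2) F} (ht : (t : Matrix (Fin 2) (Fin 2) F) = !![c, e * v; e, c + e * u]) :
    t ∈ Subgroup.centralizer ({γτ} : Set (GL (Fin 2) F)) := by
  rw [Subgroup.mem_centralizer_iff]
  intro h hh
  rw [Set.mem_singleton_iff] at hh
  subst hh
  apply Units.ext
  have hγ' : (h : Matrix (Fin 2) (Fin 2) F) = !![0, 1 * v; 1, 0 + 1 * u] := by rw [hγτ]; simp only [one_mul, zero_add]
  rw [Units.val_mul, Units.val_mul, hγ', ht, QuadraticRegularRep.regRep_comm]

/-! ## §3 The index `[TK : TKm] = q^m` -/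

include hϖ in
/-- `𝔪^m = {z ∈ 𝒪 : |z| ≤ |ϖ|^m}` for the uniformiser `ϖ` (`𝔪 = (ϖ)`). [cite: Serre1980Trees, Ch. II §1.1] -/
theorem mem_maximalIdeal_pow_iff_valuation_le_pow (m : ℕ) (z : 𝒪[F]) :
    z ∈ IsLocalRing.maximalIdeal 𝒪[F] ^ m ↔ valuation F (z : F) ≤ valuation F ϖ ^ m := by
  have h0 := hϖ.ne_zero
  rw [hϖ.span_eq, Ideal.span_singleton_pow, Ideal.mem_span_singleton]
  constructor
  · rintro ⟨w, hw⟩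
    have hw' : (z : F) = ϖ ^ m * (w : F) := by
      have := congrArg Subtype.val hw
      simpa using this
    rw [hw', map_mul, map_pow]
    exact mul_le_of_le_one_right zero_le ((Valuation.mem_integer_iff _ _).1 w.2)
  · intro hle
    have hϖm : ϖ ^ m ≠ 0 := pow_ne_zero m h0
    have hw : (z : F) * (ϖ ^ m)⁻¹ ∈ 𝒪[F] := by
      rw [Valuation.mem_integer_iff, map_mul, map_inv₀, map_pow]
      exact mul_inv_le_one_of_le₀ hle zero_le
    refine ⟨⟨(z : F) * (ϖ ^ m)⁻¹, hw⟩, Subtype.ext ?_⟩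
    show (z : F) = ((⟨ϖ, hϖ.mem⟩ : 𝒪[F]) ^ m : 𝒪[F]) * ((z : F) * (ϖ ^ m)⁻¹)
    rw [Subring.coe_pow]
    show (z : F) = ϖ ^ m * ((z : F) * (ϖ ^ m)⁻¹)
    rw [mul_comm, mul_assoc, inv_mul_cancel₀ hϖm, mul_one]

include hϖ in
/-- **THE COSET CRITERION.**  Let `t, t′ ∈ TK` with `↑t = (c, ev; e, c+eu)`, `↑t′ = (c′, e′v; e′, c′+e′u)` (so `c, c′` are units and `e, e′ ∈ 𝒪`, §1).  Then
`t⁻¹ t′ ∈ r_m GL₂(𝒪) r_m⁻¹ ⟺ |e′ c′⁻¹ − e c⁻¹| ≤ |ϖ|^m`: the τ-coordinate of `t⁻¹t′` is `e″ = (ce′ − ec′)∕N(t)`, and `r_m⁻¹ (t⁻¹t′) r_m = (c″, e″vϖ^m; e″ϖ^{−m}, c″+e″u)`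
is integral iff `|e″| ≤ |ϖ|^m` (★ I `isIntegralMatrix_shellConj_iff`). [cite: LabesseLanglands1979, §2 (2.1) p. 8] -/
theorem inv_mul_mem_conj_glInt_iff_of_mem_torusInt [IsDiscreteValuationRing 𝒪[F]] {u v : F} (hu : u ∈ 𝒪[F]) (hu1 : valuation F u < 1)
    (hv1 : valuation F v = valuation F ϖ) {γτ : GL (Fin 2) F} (hγτ : (γτ : Matrix (Fin 2) (Fin 2) F) = !![0, v; 1, u])
    {rm : GL (Fin 2) F} {m : ℕ} (hrm : (rm : Matrix (Fin 2) (Fin 2) F) = Matrix.diagonal ![1, ϖ ^ m])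
    {t t' : GL (Fin 2) F} (ht : t ∈ Subgroup.centralizer ({γτ} : Set (GL (Fin 2) F)) ⊓ glInt 2 F)
    (ht' : t' ∈ Subgroup.centralizer ({γτ} : Set (GL (Fin 2) F)) ⊓ glInt 2 F) {c e c' e' : F}
    (htc : (t : Matrix (Fin 2) (Fin 2) F) = !![c, e * v; e, c + e * u]) (htc' : (t' : Matrix (Fin 2) (Fin 2) F) = !![c', e' * v; e', c' + e' * u]) :
    t⁻¹ * t' ∈ (glInt 2 F).map (MulAut.conj rm).toMonoidHom ↔ valuation F (e' * c'⁻¹ - e * c⁻¹) ≤ valuation F ϖ ^ m := by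
  have h0 := hϖ.ne_zero
  have hϖm : ϖ ^ m ≠ 0 := pow_ne_zero m h0
  have hv : v ∈ 𝒪[F] := by rw [Valuation.mem_integer_iff, hv1]; exact hϖ.valuation_le_one
  -- entries of `t`, `t'`
  have hti := isIntegralMatrix_of_mem_glInt ht.2
  have hti' := isIntegralMatrix_of_mem_glInt ht'.2
  have hc : c ∈ 𝒪[F] := by simpa [htc] using hti 0 0
  have he : e ∈ 𝒪[F] := by simpa [htc] using hti 1 0
  have hc' : c' ∈ 𝒪[F] := by simpa [htc'] using hti' 0 0
  have he' : e' ∈ 𝒪[F] := by simpa [htc'] using hti' 1 0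
  have hdet : valuation F (c ^ 2 + c * e * u - e ^ 2 * v) = 1 := by
    rw [← QuadraticRegularRep.det_regRep, ← htc]; exact valuation_det_eq_one_of_mem_glInt ht.2
  have hdet' : valuation F (c' ^ 2 + c' * e' * u - e' ^ 2 * v) = 1 := by
    rw [← QuadraticRegularRep.det_regRep, ← htc']; exact valuation_det_eq_one_of_mem_glInt ht'.2
  have hcv : valuation F c = 1 := valuation_eq_one_of_eisenstein_norm hϖ hu1 hv1 hc he hdet
  have hcv' : valuation F c' = 1 := valuation_eq_one_of_eisenstein_norm hϖ hu1 hv1 hc' he' hdet'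
  have hc0 : c ≠ 0 := fun h => by rw [h, map_zero] at hcv; exact zero_ne_one hcv
  have hc0' : c' ≠ 0 := fun h => by rw [h, map_zero] at hcv'; exact zero_ne_one hcv'
  -- `s := t⁻¹ t'` is in the torus and in `GL₂(𝒪)`
  have hs : t⁻¹ * t' ∈ Subgroup.centralizer ({γτ} : Set (GL (Fin 2) F)) ⊓ glInt 2 F := mul_mem (inv_mem ht) ht'
  obtain ⟨c'', e'', hsc⟩ := exists_coe_eq_regRep_of_mem_centralizer_companion hγτ hs.1
  have hsi := isIntegralMatrix_of_mem_glInt hs.2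
  have hc'' : c'' ∈ 𝒪[F] := by simpa [hsc] using hsi 0 0
  have he'' : e'' ∈ 𝒪[F] := by simpa [hsc] using hsi 1 0
  -- the τ-coordinate `e''`: from `t * (t⁻¹ t') = t'`
  have hprod : (t : Matrix (Fin 2) (Fin 2) F) * ((t⁻¹ * t' : GL (Fin 2) F) : Matrix (Fin 2) (Fin 2) F) = (t' : Matrix (Fin 2) (Fin 2) F) := by
    rw [← Units.val_mul, mul_inv_cancel_left]
  rw [htc, hsc, htc', QuadraticRegularRep.regRep_mul] at hprod
  have h00 := congrArg (fun M : Matrix (Fin 2) (Fin 2) F => M 0 0) hprod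
  have h10 := congrArg (fun M : Matrix (Fin 2) (Fin 2) F => M 1 0) hprod
  simp only [Matrix.of_apply, Matrix.cons_val', Matrix.cons_val_zero, Matrix.cons_val_one, Matrix.cons_val_fin_one, Matrix.empty_val'] at h00 h10
  -- `e' c'⁻¹ − e c⁻¹ = e'' · N(t) · (c c')⁻¹`
  have hkey : e' * c'⁻¹ - e * c⁻¹ = e'' * (c ^ 2 + c * e * u - e ^ 2 * v) * (c * c')⁻¹ := by
    rw [← h10]
    field_simp
    linear_combination e * h00
  have hval : valuation F (e' * c'⁻¹ - e * c⁻¹) = valuation F e'' := by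
    rw [hkey, map_mul, map_mul, hdet, mul_one, map_inv₀, map_mul, hcv, hcv', mul_one, inv_one, mul_one]
  -- the conjugate `rm⁻¹ s rm`
  have hconj := coe_inv_mul_torus_mul_of_coe_eq_diagonal u v c'' e'' hsc hrm hϖm
  rw [Subgroup.mem_map_equiv, MulAut.conj_symm_apply, hval]
  have hdetc : valuation F ((rm⁻¹ * (t⁻¹ * t') * rm : GL (Fin 2) F) : Matrix (Fin 2) (Fin 2) F).det = 1 := by
    rw [Units.val_mul, Units.val_mul, Matrix.det_mul, Matrix.det_mul, mul_comm (((rm⁻¹ : GL (Fin 2) F) : Matrix (Fin 2) (Fin 2) F).det), mul_assoc, ← Matrix.det_mul,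
      ← Units.val_mul, inv_mul_cancel, Units.val_one, Matrix.det_one, mul_one]
    exact valuation_det_eq_one_of_mem_glInt hs.2
  rw [← map_pow, ← isIntegralMatrix_shellConj_iff hu hv hc'' he'' (hϖ.pow_mem m) hϖm, ← hconj]
  exact ⟨isIntegralMatrix_of_mem_glInt, fun h => mem_glInt_of_isIntegralMatrix h hdetc⟩

include hϖ in
/-- **THE CONDUCTOR-`m` UNIT INDEX IN EISENSTEIN COORDINATES** (the (V-INDEX) number of architect A-p16 (g28) RULING A-40 (a); LL79 p. 8 `δ_m∕2`; Labesse 2024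
Prop. 0.0.10): with `TK := Subgroup.centralizer {γτ} ⊓ GL₂(𝒪)` (`= 𝒪_E^×` as matrices) and `TKm := TK ⊓ r_m GL₂(𝒪) r_m⁻¹` (`= (𝒪 + ϖ^m𝒪τ)^×`),
**`TKm.relIndex TK = q^m`** (Mathlib `Subgroup.relIndex`), `q = #𝓀_F`.  Proof: `t ↦ e·c⁻¹ mod 𝔪^m` is a bijection of coset spaces `TK ∕ TKm → 𝒪 ∕ 𝔪^m` (coset criterion + onto by `t = 1 + eτ`),
and `#(𝒪∕𝔪^m) = q^m`.  (V-ORBIT) (A-p17 (g23)) turns this into the shell cardinality `#{x | d x = m} = 2·q^m` of the tree of `SL₂(F)`.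
[cite: LabesseLanglands1979, §2 p. 8] [cite: Labesse2024StabilisationGermesSL2, Prop. 0.0.10] [cite: Serre1980Trees, Ch. II §1.1, §1.3] -/
theorem relIndex_torusInt_shellStab_eq [IsDiscreteValuationRing 𝒪[F]] [Finite (IsLocalRing.ResidueField 𝒪[F])] {u v : F} (hu : u ∈ 𝒪[F])
    (hu1 : valuation F u < 1) (hv1 : valuation F v = valuation F ϖ) {γτ : GL (Fin 2) F} (hγτ : (γτ : Matrix (Fin 2) (Fin 2) F) = !![0, v; 1, u])
    {rm : GL (Fin 2) F} {m : ℕ} (hrm : (rm : Matrix (Fin 2) (Fin 2) F) = Matrix.diagonal ![1, ϖ ^ m]) :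
    ((Subgroup.centralizer ({γτ} : Set (GL (Fin 2) F)) ⊓ glInt 2 F) ⊓ (glInt 2 F).map (MulAut.conj rm).toMonoidHom).relIndex
      (Subgroup.centralizer ({γτ} : Set (GL (Fin 2) F)) ⊓ glInt 2 F) = Nat.card (IsLocalRing.ResidueField 𝒪[F]) ^ m := by
  classical
  have h0 := hϖ.ne_zero
  have hv : v ∈ 𝒪[F] := by rw [Valuation.mem_integer_iff, hv1]; exact hϖ.valuation_le_one
  set TK : Subgroup (GL (Fin 2) F) := Subgroup.centralizer ({γτ} : Set (GL (Fin 2) F)) ⊓ glInt 2 F with hTK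
  set TKm : Subgroup (GL (Fin 2) F) := TK ⊓ (glInt 2 F).map (MulAut.conj rm).toMonoidHom with hTKm
  set H : Subgroup TK := TKm.subgroupOf TK with hH
  -- coordinates of an element of `TK`: `c = t₀₀` (a unit), `e = t₁₀ ∈ 𝒪`
  have hcoord : ∀ t : TK, ∃ c e : F, ((t : GL (Fin 2) F) : Matrix (Fin 2) (Fin 2) F) = !![c, e * v; e, c + e * u] ∧ valuation F c = 1 ∧ e ∈ 𝒪[F] := by
    intro t
    obtain ⟨c, e, htc⟩ := exists_coe_eq_regRep_of_mem_centralizer_companion hγτ t.2.1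
    have hti := isIntegralMatrix_of_mem_glInt t.2.2
    have hc : c ∈ 𝒪[F] := by simpa [htc] using hti 0 0
    have he : e ∈ 𝒪[F] := by simpa [htc] using hti 1 0
    have hdet : valuation F (c ^ 2 + c * e * u - e ^ 2 * v) = 1 := by
      rw [← QuadraticRegularRep.det_regRep, ← htc]; exact valuation_det_eq_one_of_mem_glInt t.2.2
    exact ⟨c, e, htc, valuation_eq_one_of_eisenstein_norm hϖ hu1 hv1 hc he hdet, he⟩
  -- the class map `ψ t = e c⁻¹ mod 𝔪^m`, read off the entries `t₁₀ · t₀₀⁻¹`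
  have hentry : ∀ t : TK, ((t : GL (Fin 2) F) : Matrix (Fin 2) (Fin 2) F) 1 0 * (((t : GL (Fin 2) F) : Matrix (Fin 2) (Fin 2) F) 0 0)⁻¹ ∈ 𝒪[F] := by
    intro t
    obtain ⟨c, e, htc, hcv, he⟩ := hcoord t
    have h1 : ((t : GL (Fin 2) F) : Matrix (Fin 2) (Fin 2) F) 1 0 = e := by rw [htc]; rfl
    have h2 : ((t : GL (Fin 2) F) : Matrix (Fin 2) (Fin 2) F) 0 0 = c := by rw [htc]; rfl
    rw [h1, h2, Valuation.mem_integer_iff, map_mul, map_inv₀, hcv, inv_one, mul_one]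
    exact (Valuation.mem_integer_iff _ _).1 he
  set ψ : TK → 𝒪[F] ⧸ IsLocalRing.maximalIdeal 𝒪[F] ^ m := fun t =>
    Ideal.Quotient.mk _ ⟨((t : GL (Fin 2) F) : Matrix (Fin 2) (Fin 2) F) 1 0 * (((t : GL (Fin 2) F) : Matrix (Fin 2) (Fin 2) F) 0 0)⁻¹, hentry t⟩ with hψ
  -- KEY: `ψ t = ψ t' ↔ t⁻¹ t' ∈ H`
  have hkey : ∀ t t' : TK, ψ t = ψ t' ↔ t⁻¹ * t' ∈ H := by
    intro t t'
    obtain ⟨c, e, htc, hcv, he⟩ := hcoord t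
    obtain ⟨c', e', htc', hcv', he'⟩ := hcoord t'
    have h1 : ((t : GL (Fin 2) F) : Matrix (Fin 2) (Fin 2) F) 1 0 = e := by rw [htc]; rfl
    have h2 : ((t : GL (Fin 2) F) : Matrix (Fin 2) (Fin 2) F) 0 0 = c := by rw [htc]; rfl
    have h1' : ((t' : GL (Fin 2) F) : Matrix (Fin 2) (Fin 2) F) 1 0 = e' := by rw [htc']; rfl
    have h2' : ((t' : GL (Fin 2) F) : Matrix (Fin 2) (Fin 2) F) 0 0 = c' := by rw [htc']; rfl
    rw [hH, Subgroup.mem_subgroupOf, Subgroup.coe_mul, Subgroup.coe_inv, hTKm, Subgroup.mem_inf]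
    have hmemTK : ((t : GL (Fin 2) F))⁻¹ * (t' : GL (Fin 2) F) ∈ TK := mul_mem (inv_mem t.2) t'.2
    simp only [hmemTK, true_and]
    rw [inv_mul_mem_conj_glInt_iff_of_mem_torusInt hϖ hu hu1 hv1 hγτ hrm t.2 t'.2 htc htc', hψ]
    simp only [h1, h2, h1', h2']
    rw [eq_comm, Ideal.Quotient.eq, mem_maximalIdeal_pow_iff_valuation_le_pow hϖ]
    rfl
  -- the induced map on the coset space is a bijection onto `𝒪 ⧸ 𝔪^m`
  set Φ : (TK ⧸ H) → 𝒪[F] ⧸ IsLocalRing.maximalIdeal 𝒪[F] ^ m :=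
    Quotient.lift (s := QuotientGroup.leftRel H) ψ (fun a b hab => (hkey a b).2 (QuotientGroup.leftRel_apply.1 hab)) with hΦ
  have hinj : Function.Injective Φ := by
    intro x y
    induction x using Quotient.inductionOn with | h a => ?_
    induction y using Quotient.inductionOn with | h b => ?_
    intro hab
    exact Quotient.sound (QuotientGroup.leftRel_apply.2 ((hkey a b).1 hab))
  have hsurj : Function.Surjective Φ := by
    intro y
    obtain ⟨z, rfl⟩ := Ideal.Quotient.mk_surjective y
    -- the torus element `1 + zτ`
    have hdetN : valuation F ((1 : F) ^ 2 + 1 * (z : F) * u - (z : F) ^ 2 * v) = 1 := valuation_eisenstein_norm_one_add hϖ hu1 hv1 z.2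
    have hdet0 : (!![(1 : F), (z : F) * v; (z : F), 1 + (z : F) * u]).det ≠ 0 := by
      rw [QuadraticRegularRep.det_regRep]
      intro h; rw [h, map_zero] at hdetN; exact zero_ne_one hdetN
    set n : GL (Fin 2) F := Matrix.GeneralLinearGroup.mk'' _ (isUnit_iff_ne_zero.2 hdet0) with hn
    have hncoe : (n : Matrix (Fin 2) (Fin 2) F) = !![(1 : F), (z : F) * v; (z : F), 1 + (z : F) * u] := rfl
    have hnK : n ∈ glInt 2 F := by
      refine mem_glInt_of_isIntegralMatrix (fun i j => ?_) (by rw [hncoe, QuadraticRegularRep.det_regRep]; exact hdetN)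
      rw [hncoe]
      fin_cases i <;> fin_cases j
      · exact one_mem _
      · exact mul_mem z.2 hv
      · exact z.2
      · exact add_mem (one_mem _) (mul_mem z.2 hu)
    have hnTK : n ∈ TK := ⟨regRep_mem_centralizer_companion hγτ hncoe, hnK⟩
    refine ⟨Quotient.mk _ ⟨n, hnTK⟩, ?_⟩
    show ψ ⟨n, hnTK⟩ = Ideal.Quotient.mk _ z
    have hval : ((⟨n, hnTK⟩ : TK) : GL (Fin 2) F) = n := rfl
    have h10 : (n : Matrix (Fin 2) (Fin 2) F) 1 0 * ((n : Matrix (Fin 2) (Fin 2) F) 0 0)⁻¹ = (z : F) := by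
      rw [hncoe]; simp
    rw [hψ]
    dsimp only
    congr 1
    exact Subtype.ext h10
  -- count
  have hcard : Nat.card (TK ⧸ H) = Nat.card (𝒪[F] ⧸ IsLocalRing.maximalIdeal 𝒪[F] ^ m) := Nat.card_eq_of_bijective Φ ⟨hinj, hsurj⟩
  have hq : Nat.card (𝒪[F] ⧸ IsLocalRing.maximalIdeal 𝒪[F] ^ m) = Nat.card (IsLocalRing.ResidueField 𝒪[F]) ^ m := by
    have h := cardQuot_pow_of_prime (S := 𝒪[F]) (P := IsLocalRing.maximalIdeal 𝒪[F]) (IsDiscreteValuationRing.not_a_field _) (i := m)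
    rw [Submodule.cardQuot_apply, Submodule.cardQuot_apply] at h
    exact h
  show (TKm.subgroupOf TK).index = _
  rw [← hH]
  show Nat.card (TK ⧸ H) = _
  rw [hcard, hq]

end Literature.NumberTheory.Automorphic.HermitianLatticeTree

end
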